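import Summits.Ventures.LatticeQCDFlow.Exactness.IMHCouplingChiSquareRate
import HarnessLib

/-!
# What the certificate must be told: with the target known only up to its normaliser `Z ∈ [Z_lo, Z_hi]`, every input of the
# every-weight Bernstein bar is the `q`-expectation of a BOUNDED function of the unnormalised weight — measurable from the proposals —
# except the upper bound `Z_hi`

HONEST FRAMING: exact (Metropolis-corrected) sampling algorithms for lattice gauge theory;
figures of merit are autocorrelation/cost numbers at stated couplings and volumes; no
continuum-physics claim.

Venture `LatticeQCDFlow` (cell pub-lqcd), topic `Exactness`; FANOUT row 30 (lean-1, GEN-41).  NEW WORK of the cell, general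
(standard Borel) state space.  GEN-40's `crnLag_replicas_burnIn_bernstein_abs_target_everyWeight` certifies the coupled flow-MCMC
estimate about `π f` for EVERY positive normalised weight `w = dπ/dq`, with three inputs that the run does not print:
`c₁ = E_q[min(1, w)]`, `q{w > M}` and `π{w > M}` (plus `w(x) ≤ M` at the start).  In lattice practice the weight is known only
UNNORMALISED, `w̃ = e^{−S}/q̃ = Z·w` with `Z = E_q[w̃]` unknown.  This file shows what must be supplied and what can be measured.

* §1 **`crnLag_replicas_burnIn_bernstein_abs_target_of_inputs`** — THE PLUG-IN FORM: the bar holds with ANY lower bound `c₀ ≤ c₁` and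
  ANY upper bounds `t_q ≥ q{w > M}`, `t_π ≥ π{w > M}` in place of the exact inputs (monotonicity of the bound).
* §2 (a bracket `0 < Z_lo ≤ Z ≤ Z_hi`, `w = w̃/Z`, level `M ≥ 0`) `lintegral_min_one_unnormalised_le` — `E_q[min(1, w̃/Z_hi)] ≤ c₁`;
  `measure_weight_gt_le_unnormalised` — `q{w > M} ≤ q{w̃ > M·Z_lo}`; **`target_weight_gt_le_unnormalised`** —
  `π{w > M} ≤ 1 − E_q[w̃·1{w̃ ≤ M·Z_lo}]/Z_hi`; `weight_le_of_unnormalised_le` — `w̃(x) ≤ M·Z_lo ⇒ w(x) ≤ M`;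
  `integral_min_unnormalised_le_normaliser` — `E_q[min(w̃, B)] ≤ Z` for every cut `B` (so `Z_lo` is certifiable from proposals).
  The three proxies `min(1, w̃/Z_hi) ∈ [0, 1]`, `1{w̃ > M·Z_lo} ∈ {0, 1}`, `w̃·1{w̃ ≤ M·Z_lo} ∈ [0, M·Z_lo]` and `min(w̃, B) ∈ [0, B]` are
  BOUNDED measurable functions of the proposal: their `q`-means carry one-sided Hoeffding bars from `n` proposals
  (`IMHCoupledEstimatorHoeffding.hoeffding_avg_ge_of_mem_Icc` ∕ `_le_`), `proxies_mem_Icc`.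
* §3 **`crnLag_replicas_burnIn_bernstein_abs_target_unnormalised`** — the every-weight Bernstein bar about `π f` with the inputs
  REPLACED by the bracket proxies: from `x` with `w̃(x) ≤ M·Z_lo`,
  `P(|H̄_R − π f| ≥ ε + (c − a)(1 − s/Z_hi + ρ₀^k)) ≤ 2·exp(−Rε²/(2(σ² + (c − a)ε/3))) + R·(q{w̃ > M·Z_lo} + ρ₀^k)`,
  `s = E_q[w̃·1{w̃ ≤ M·Z_lo}]`, `ρ₀ = 1 − E_q[min(1, w̃/Z_hi)]/max(1, M)`; and **`…_target_of_estimates`** — the same with any certified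
  numbers `ĉ ≤ E_q[min(1, w̃/Z_hi)]`, `t̂ ≥ q{w̃ > M·Z_lo}`, `ŝ ≤ s` (each obtainable from the proposal stream at a declared risk).
Reading: given an a-priori UPPER bound `Z_hi` on the normaliser (a lower bound on the free-energy difference between target and
model) — and nothing else about the target — every input of the certified error bar is measured from the flow's own proposals with
its own Hoeffding bar; the lower end `Z_lo` is itself measured (`E_q[min(w̃, B)] ≤ Z`).  GEN-41's `HiddenSectorNoCertificate` shows
that SOME such a-priori input is necessary; this file shows that `Z_hi` suffices.  NOT CLAIMED: a certificate for `Z_hi` (none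
exists from proposals alone); the product-space statement combining the calibration risk with the run's risk (union bound, left to
the reader: total risk `δ + Σδ_cal`).  No `sorry`, no new definitions, nothing cited as a fact.
-/

noncomputable section

namespace Summit.Ventures.LatticeQCDFlow.Exactness

open MeasureTheory ProbabilityTheory Function Finset Filter
open scoped _root_.ENNReal unitInterval Topology
open Summit.Ventures.LatticeQCDFlow.Scoring

variable {Ω : Type*} [MeasurableSpace Ω] {q : Measure Ω} [IsProbabilityMeasure q] {w : Ω → ℝ}

/-! ## §1 The plug-in form: the bar with bounds in place of the exact inputs -/

section Replicas

variable {Ω' : Type*} {mΩ' : MeasurableSpace Ω'} {μ : Measure Ω'} [IsProbabilityMeasure μ]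
  {Z : ℕ → Ω' → (ℕ → Ω × Ω)}

/-- **THE EVERY-WEIGHT BERNSTEIN BAR WITH INPUT BOUNDS**: in the setting of `crnLag_replicas_burnIn_bernstein_abs_target_everyWeight`
(standard Borel `Ω`, production run at `x` with `w(x) ≤ M`, leading run one update ahead, `R ≥ 1` independent coupled pairs, window `N`,
burn-in `k`, `σ² ≥ Var_{δ_xK^k} f > 0`, `ε ≥ 0`), for ANY `c₀ ≤ c₁ = E_q[min(1, w)]` and ANY finite `t_q ≥ q{M < w}`, `t_π ≥ π{M < w}`:
`P(|H̄_R − π f| ≥ ε + (c − a)(t_π + ρ₀^k)) ≤ 2·exp(−Rε²/(2(σ² + (c − a)ε/3))) + R·(t_q + ρ₀^k)`, `ρ₀ = 1 − c₀/max(1, M)`. [ours] -/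
theorem crnLag_replicas_burnIn_bernstein_abs_target_of_inputs [StandardBorelSpace Ω] [Nonempty Ω] [MeasurableSingletonClass Ω]
    [MeasurableEq Ω] [Fact (Measurable w)] (hw0 : ∀ y, 0 < w y) [IsProbabilityMeasure (q.withDensity fun y => ENNReal.ofReal (w y))]
    (Khat : Kernel (Ω × Ω) (Ω × Ω)) [IsMarkovKernel Khat]
    (hK : ∀ z : Ω × Ω, Khat z = (q.prod (volume : Measure unitInterval)).map (fun p : Ω × unitInterval =>
      ((if (p.2 : ℝ) * w z.1 ≤ w p.1 then p.1 else z.1), (if (p.2 : ℝ) * w z.2 ≤ w p.1 then p.1 else z.2))))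
    (x : Ω) {M : ℝ} (hxM : w x ≤ M) (ν : Measure (Ω × Ω)) [IsProbabilityMeasure ν]
    (hν : ν = (indepMH q w x).map fun y : Ω => (y, x)) {f : Ω → ℝ} (hf : Measurable f) {a c : ℝ} (ha : ∀ y, a ≤ f y)
    (hc : ∀ y, f y ≤ c) (k N : ℕ) (hZm : ∀ j, Measurable (Z j))
    (hlaw : ∀ j, μ.map (Z j) = Kernel.trajMeasure (X := fun _ : ℕ => Ω × Ω) ν
      (fun n : ℕ => Khat.comap (fun h : (i : ↥(Finset.Iic n)) → Ω × Ω => h ⟨n, Finset.mem_Iic.2 le_rfl⟩)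
        (measurable_pi_apply _)))
    (hind : iIndepFun Z μ) {σ2 : ℝ} (hσ : 0 < σ2)
    (hσk : variance f ((fun m : Measure Ω => m.bind (indepMH q w))^[k] (Measure.dirac x)) ≤ σ2)
    {ε : ℝ} (hε : 0 ≤ ε) {R : ℕ} (hR : 1 ≤ R) {c₀ tq tπ : ℝ≥0∞} (hc₀ : c₀ ≤ ∫⁻ y, ENNReal.ofReal (min 1 (w y)) ∂q)
    (htq : q {y | M < w y} ≤ tq) (htq' : tq ≠ ⊤)
    (htπ : (q.withDensity fun y => ENNReal.ofReal (w y)) {y | M < w y} ≤ tπ) (htπ' : tπ ≠ ⊤) :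
    μ.real {ω | ε + (c - a) * (tπ + (1 - c₀ / ENNReal.ofReal (max 1 M)) ^ k).toReal ≤
        |(R : ℝ)⁻¹ * ∑ j ∈ range R, (f ((Z j ω k).2) + ∑ n ∈ range N, (f ((Z j ω (k + n)).1) - f ((Z j ω (k + n)).2))) -
          ∫ y, f y ∂(q.withDensity fun y => ENNReal.ofReal (w y))|} ≤
      2 * Real.exp (-(R * ε ^ 2) / (2 * (σ2 + (c - a) * ε / 3))) + R * (tq + (1 - c₀ / ENNReal.ofReal (max 1 M)) ^ k).toReal := by
  have hca : 0 ≤ c - a := by linarith [ha x, hc x]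
  set πm : Measure Ω := q.withDensity fun y => ENNReal.ofReal (w y) with hπm
  set c₁ := ∫⁻ y, ENNReal.ofReal (min 1 (w y)) ∂q with hc₁
  set r : ℝ≥0∞ := (1 - c₁ / ENNReal.ofReal (max 1 M)) ^ k with hr
  set r₀ : ℝ≥0∞ := (1 - c₀ / ENNReal.ofReal (max 1 M)) ^ k with hr₀
  have hrr : r ≤ r₀ := pow_le_pow_left' (tsub_le_tsub_left (ENNReal.div_le_div_right hc₀ _) 1) k
  have hr₀1 : r₀ ≤ 1 := (pow_le_pow_left' tsub_le_self k).trans_eq (one_pow k)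
  have hr₀T : r₀ ≠ ⊤ := ne_top_of_le_ne_top ENNReal.one_ne_top hr₀1
  have h := crnLag_replicas_burnIn_bernstein_abs_target_everyWeight hw0 Khat hK x hxM ν hν hf ha hc k N hZm hlaw hind hσ hσk hε hR
  have htail_q : (q {y | M < w y} + r).toReal ≤ (tq + r₀).toReal :=
    ENNReal.toReal_mono (ENNReal.add_ne_top.2 ⟨htq', hr₀T⟩) (add_le_add htq hrr)
  have htail_π : (πm {y | M < w y} + r).toReal ≤ (tπ + r₀).toReal :=
    ENNReal.toReal_mono (ENNReal.add_ne_top.2 ⟨htπ', hr₀T⟩) (add_le_add htπ hrr)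
  have hRnn : (0 : ℝ) ≤ R := Nat.cast_nonneg R
  refine le_trans (le_trans (measureReal_mono fun ω hω => ?_) h) ?_
  · simp only [Set.mem_setOf_eq] at hω ⊢
    have := mul_le_mul_of_nonneg_left htail_π hca
    linarith
  · gcongr

end Replicas

/-! ## §2 The bracket proxies (deterministic comparisons) -/

section Proxies

variable {wt : Ω → ℝ} {Z Zlo Zhi : ℝ}

omit [IsProbabilityMeasure q] in
/-- **`E_q[min(1, w̃/Z_hi)] ≤ c₁ = E_q[min(1, w)]`** for `w = w̃/Z`, `w̃ ≥ 0`, `0 < Z ≤ Z_hi` (`ℝ≥0∞`). [ours] -/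
theorem lintegral_min_one_unnormalised_le (hwZ : ∀ y, w y = wt y / Z) (hwt0 : ∀ y, 0 ≤ wt y) (hZ : 0 < Z) (hZhi : Z ≤ Zhi) :
    ∫⁻ y, ENNReal.ofReal (min 1 (wt y / Zhi)) ∂q ≤ ∫⁻ y, ENNReal.ofReal (min 1 (w y)) ∂q :=
  lintegral_mono fun y => ENNReal.ofReal_le_ofReal (min_le_min le_rfl (by
    rw [hwZ y]; exact div_le_div_of_nonneg_left (hwt0 y) hZ hZhi))

omit [IsProbabilityMeasure q] in
/-- **`q{M < w} ≤ q{M·Z_lo < w̃}`** for `w = w̃/Z`, `0 < Z_lo ≤ Z`, `M ≥ 0`. [ours] -/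
theorem measure_weight_gt_le_unnormalised (hwZ : ∀ y, w y = wt y / Z) (hZlo : 0 < Zlo) (hZloZ : Zlo ≤ Z) {M : ℝ} (hM : 0 ≤ M) :
    q {y | M < w y} ≤ q {y | M * Zlo < wt y} := by
  refine measure_mono fun y hy => ?_
  simp only [Set.mem_setOf_eq] at hy ⊢
  have hZ : 0 < Z := lt_of_lt_of_le hZlo hZloZ
  rw [hwZ y, lt_div_iff₀ hZ] at hy
  calc M * Zlo ≤ M * Z := mul_le_mul_of_nonneg_left hZloZ hM
    _ < wt y := hy

omit [MeasurableSpace Ω] [IsProbabilityMeasure q] in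
/-- `w̃(x) ≤ M·Z_lo ⇒ w(x) ≤ M` for `w = w̃/Z`, `0 < Z_lo ≤ Z`, `M ≥ 0`. [ours, bookkeeping] -/
theorem weight_le_of_unnormalised_le (hwZ : ∀ y, w y = wt y / Z) (hZlo : 0 < Zlo) (hZloZ : Zlo ≤ Z) {M : ℝ} (hM : 0 ≤ M) {x : Ω}
    (hx : wt x ≤ M * Zlo) : w x ≤ M := by
  have hZ : 0 < Z := lt_of_lt_of_le hZlo hZloZ
  rw [hwZ x, div_le_iff₀ hZ]
  exact hx.trans (mul_le_mul_of_nonneg_left hZloZ hM)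

omit [IsProbabilityMeasure q] in
/-- **`π{M < w} ≤ 1 − E_q[w̃·1{w̃ ≤ M·Z_lo}]/Z_hi`** (`π = w·q` a probability measure, `w = w̃/Z` measurable, `w̃ ≥ 0`,
`0 < Z_lo ≤ Z ≤ Z_hi`, `M ≥ 0`): the light part of the target is under-counted by the truncated proxy. [ours] -/
theorem target_weight_gt_le_unnormalised (hw : Measurable w) (hw0 : ∀ y, 0 < w y)
    [IsProbabilityMeasure (q.withDensity fun y => ENNReal.ofReal (w y))] (hwt : Measurable wt) (hwZ : ∀ y, w y = wt y / Z)
    (hwt0 : ∀ y, 0 ≤ wt y) (hZlo : 0 < Zlo) (hZloZ : Zlo ≤ Z) (hZhi : Z ≤ Zhi) {M : ℝ} (hM : 0 ≤ M) :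
    (q.withDensity fun y => ENNReal.ofReal (w y)) {y | M < w y} ≤
      ENNReal.ofReal (1 - (∫ y, Set.indicator {y | wt y ≤ M * Zlo} wt y ∂q) / Zhi) := by
  set πm : Measure Ω := q.withDensity fun y => ENNReal.ofReal (w y) with hπm
  have hZ : 0 < Z := lt_of_lt_of_le hZlo hZloZ
  have hZhi0 : 0 < Zhi := lt_of_lt_of_le hZ hZhi
  have hSm : MeasurableSet {y | M < w y} := measurableSet_lt measurable_const hw
  have hTm : MeasurableSet {y | wt y ≤ M * Zlo} := measurableSet_le hwt measurable_const
  -- `π{w ≤ M} = ∫_{w ≤ M} w dq ≥ ∫ w̃·1{w̃ ≤ M Z_lo} dq / Z_hi`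
  have hcompl : πm {y | M < w y} = 1 - πm {y | M < w y}ᶜ := by
    have h := measure_add_measure_compl (μ := πm) hSm
    rw [measure_univ] at h
    exact ENNReal.eq_sub_of_add_eq (measure_ne_top _ _) h
  have hle : {y | M < w y}ᶜ = {y | w y ≤ M} := by ext y; simp only [Set.mem_compl_iff, Set.mem_setOf_eq, not_lt]
  -- the integrand comparison
  have hpt : ∀ y, Set.indicator {y | wt y ≤ M * Zlo} wt y / Zhi ≤ Set.indicator {y | w y ≤ M} w y := by
    intro y
    by_cases hy : wt y ≤ M * Zlo
    · have hwy : w y ≤ M := weight_le_of_unnormalised_le hwZ hZlo hZloZ hM hy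
      rw [Set.indicator_of_mem (show y ∈ {y | wt y ≤ M * Zlo} from hy),
        Set.indicator_of_mem (show y ∈ {y | w y ≤ M} from hwy), hwZ y]
      exact div_le_div_of_nonneg_left (hwt0 y) hZ hZhi
    · rw [Set.indicator_of_notMem (show y ∉ {y | wt y ≤ M * Zlo} from hy), zero_div]
      exact Set.indicator_nonneg (fun z _ => (hw0 z).le) y
  have hwi : Integrable w q := (integrable_weight_and_integral_eq_one (q := q) hw hw0).1
  have hIi : Integrable (Set.indicator {y | w y ≤ M} w) q := hwi.indicator (measurableSet_le hw measurable_const)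
  have hint : (∫ y, Set.indicator {y | wt y ≤ M * Zlo} wt y ∂q) / Zhi ≤ ∫ y, Set.indicator {y | w y ≤ M} w y ∂q := by
    rw [div_eq_mul_inv, ← integral_mul_const]
    refine integral_mono_of_nonneg (ae_of_all _ fun y => ?_) hIi (ae_of_all _ fun y => by
      simpa [div_eq_mul_inv] using hpt y)
    exact mul_nonneg (Set.indicator_nonneg (fun z _ => hwt0 z) y) (inv_nonneg.2 hZhi0.le)
  -- `π{w ≤ M} = ofReal (∫ 1{w ≤ M} w dq)`
  have hπle : πm {y | w y ≤ M} = ENNReal.ofReal (∫ y, Set.indicator {y | w y ≤ M} w y ∂q) := by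
    rw [hπm, withDensity_apply _ (measurableSet_le hw measurable_const), integral_indicator (measurableSet_le hw measurable_const),
      ofReal_integral_eq_lintegral_ofReal hwi.integrableOn (ae_of_all _ fun y => (hw0 y).le)]
  have hs1 : ∫ y, Set.indicator {y | w y ≤ M} w y ∂q ≤ 1 := by
    have h := measure_mono (μ := πm) (Set.subset_univ {y | w y ≤ M})
    rw [measure_univ, hπle] at h
    exact (ENNReal.ofReal_le_one.1 h)
  rw [hcompl, hle, hπle]
  have hs0 : 0 ≤ ∫ y, Set.indicator {y | w y ≤ M} w y ∂q := integral_nonneg fun y => Set.indicator_nonneg (fun z _ => (hw0 z).le) y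
  rw [← ENNReal.ofReal_one, ← ENNReal.ofReal_sub 1 hs0]
  exact ENNReal.ofReal_le_ofReal (by linarith)

omit [IsProbabilityMeasure q] in
/-- **`E_q[min(w̃, B)] ≤ Z`** when `∫ w̃ dq = Z`, `w̃ ≥ 0` integrable, `B ≥ 0`: the normaliser is certifiable FROM BELOW by a
truncated (bounded) mean. [ours] -/
theorem integral_min_unnormalised_le_normaliser (hwti : Integrable wt q) (hwt0 : ∀ y, 0 ≤ wt y) (hZ : ∫ y, wt y ∂q = Z) {B : ℝ}
    (hB : 0 ≤ B) : ∫ y, min (wt y) B ∂q ≤ Z := by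
  rw [← hZ]
  exact integral_mono_of_nonneg (ae_of_all _ fun y => le_min (hwt0 y) hB) hwti (ae_of_all _ fun y => min_le_left _ _)

omit [MeasurableSpace Ω] in
/-- The four proxies are bounded: `min(1, w̃/Z_hi) ∈ [0, 1]`, `1{M·Z_lo < w̃} ∈ [0, 1]`, `w̃·1{w̃ ≤ M·Z_lo} ∈ [0, M·Z_lo]`,
`min(w̃, B) ∈ [0, B]` (`w̃ ≥ 0`, `Z_hi > 0`, `M·Z_lo ≥ 0`, `B ≥ 0`) — so their `q`-means carry Hoeffding bars from the proposals.
[ours, bookkeeping] -/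
theorem proxies_mem_Icc (hwt0 : ∀ y, 0 ≤ wt y) (hZhi : 0 < Zhi) {M B : ℝ} (hMZ : 0 ≤ M * Zlo) (hB : 0 ≤ B) (y : Ω) :
    min 1 (wt y / Zhi) ∈ Set.Icc (0 : ℝ) 1 ∧ Set.indicator {y | M * Zlo < wt y} (fun _ => (1 : ℝ)) y ∈ Set.Icc (0 : ℝ) 1 ∧
      Set.indicator {y | wt y ≤ M * Zlo} wt y ∈ Set.Icc (0 : ℝ) (M * Zlo) ∧ min (wt y) B ∈ Set.Icc (0 : ℝ) B := by
  refine ⟨⟨le_min zero_le_one (div_nonneg (hwt0 y) hZhi.le), min_le_left _ _⟩, ?_, ?_, ⟨le_min (hwt0 y) hB, min_le_right _ _⟩⟩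
  · by_cases h : M * Zlo < wt y
    · rw [Set.indicator_of_mem (show y ∈ {y | M * Zlo < wt y} from h)]; exact ⟨zero_le_one, le_rfl⟩
    · rw [Set.indicator_of_notMem (show y ∉ {y | M * Zlo < wt y} from h)]; exact ⟨le_rfl, zero_le_one⟩
  · by_cases h : wt y ≤ M * Zlo
    · rw [Set.indicator_of_mem (show y ∈ {y | wt y ≤ M * Zlo} from h)]; exact ⟨hwt0 y, h⟩
    · rw [Set.indicator_of_notMem (show y ∉ {y | wt y ≤ M * Zlo} from h)]; exact ⟨le_rfl, hMZ⟩

end Proxies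

/-! ## §3 The bar with the bracket proxies -/

section Calibrated

variable {Ω' : Type*} {mΩ' : MeasurableSpace Ω'} {μ : Measure Ω'} [IsProbabilityMeasure μ]
  {Z : ℕ → Ω' → (ℕ → Ω × Ω)} {wt : Ω → ℝ} {Znorm Zlo Zhi : ℝ}

/-- **THE EVERY-WEIGHT BERNSTEIN BAR FROM A NORMALISER BRACKET**: the target known as `w̃ = Z·w` with `0 < Z_lo ≤ Z ≤ Z_hi`,
`w̃ ≥ 0` measurable; start at `x` with `w̃(x) ≤ M·Z_lo`, `M ≥ 0`; then with `s = E_q[w̃·1{w̃ ≤ M·Z_lo}]`,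
`ρ₀ = 1 − E_q[min(1, w̃/Z_hi)]/max(1, M)`:
`P(|H̄_R − π f| ≥ ε + (c − a)(1 − s/Z_hi + ρ₀^k)) ≤ 2·exp(−Rε²/(2(σ² + (c − a)ε/3))) + R·(q{M·Z_lo < w̃} + ρ₀^k)` — every input
except `Z_hi` is the `q`-mean of a bounded function of the proposal. [ours] -/
theorem crnLag_replicas_burnIn_bernstein_abs_target_unnormalised [StandardBorelSpace Ω] [Nonempty Ω] [MeasurableSingletonClass Ω]
    [MeasurableEq Ω] [Fact (Measurable w)] (hw0 : ∀ y, 0 < w y) [IsProbabilityMeasure (q.withDensity fun y => ENNReal.ofReal (w y))]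
    (hwt : Measurable wt) (hwZ : ∀ y, w y = wt y / Znorm) (hwt0 : ∀ y, 0 ≤ wt y) (hZlo : 0 < Zlo) (hZloZ : Zlo ≤ Znorm)
    (hZhi : Znorm ≤ Zhi) (Khat : Kernel (Ω × Ω) (Ω × Ω)) [IsMarkovKernel Khat]
    (hK : ∀ z : Ω × Ω, Khat z = (q.prod (volume : Measure unitInterval)).map (fun p : Ω × unitInterval =>
      ((if (p.2 : ℝ) * w z.1 ≤ w p.1 then p.1 else z.1), (if (p.2 : ℝ) * w z.2 ≤ w p.1 then p.1 else z.2))))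
    (x : Ω) {M : ℝ} (hM : 0 ≤ M) (hxM : wt x ≤ M * Zlo) (ν : Measure (Ω × Ω)) [IsProbabilityMeasure ν]
    (hν : ν = (indepMH q w x).map fun y : Ω => (y, x)) {f : Ω → ℝ} (hf : Measurable f) {a c : ℝ} (ha : ∀ y, a ≤ f y)
    (hc : ∀ y, f y ≤ c) (k N : ℕ) (hZm : ∀ j, Measurable (Z j))
    (hlaw : ∀ j, μ.map (Z j) = Kernel.trajMeasure (X := fun _ : ℕ => Ω × Ω) ν
      (fun n : ℕ => Khat.comap (fun h : (i : ↥(Finset.Iic n)) → Ω × Ω => h ⟨n, Finset.mem_Iic.2 le_rfl⟩)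
        (measurable_pi_apply _)))
    (hind : iIndepFun Z μ) {σ2 : ℝ} (hσ : 0 < σ2)
    (hσk : variance f ((fun m : Measure Ω => m.bind (indepMH q w))^[k] (Measure.dirac x)) ≤ σ2)
    {ε : ℝ} (hε : 0 ≤ ε) {R : ℕ} (hR : 1 ≤ R) :
    μ.real {ω | ε + (c - a) * (ENNReal.ofReal (1 - (∫ y, Set.indicator {y | wt y ≤ M * Zlo} wt y ∂q) / Zhi) +
          (1 - (∫⁻ y, ENNReal.ofReal (min 1 (wt y / Zhi)) ∂q) / ENNReal.ofReal (max 1 M)) ^ k).toReal ≤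
        |(R : ℝ)⁻¹ * ∑ j ∈ range R, (f ((Z j ω k).2) + ∑ n ∈ range N, (f ((Z j ω (k + n)).1) - f ((Z j ω (k + n)).2))) -
          ∫ y, f y ∂(q.withDensity fun y => ENNReal.ofReal (w y))|} ≤
      2 * Real.exp (-(R * ε ^ 2) / (2 * (σ2 + (c - a) * ε / 3))) +
        R * (q {y | M * Zlo < wt y} + (1 - (∫⁻ y, ENNReal.ofReal (min 1 (wt y / Zhi)) ∂q) / ENNReal.ofReal (max 1 M)) ^ k).toReal := by
  have hw : Measurable w := Fact.out
  have hZ : 0 < Znorm := lt_of_lt_of_le hZlo hZloZ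
  exact crnLag_replicas_burnIn_bernstein_abs_target_of_inputs hw0 Khat hK x (weight_le_of_unnormalised_le hwZ hZlo hZloZ hM hxM)
    ν hν hf ha hc k N hZm hlaw hind hσ hσk hε hR (lintegral_min_one_unnormalised_le hwZ hwt0 hZ hZhi)
    (measure_weight_gt_le_unnormalised hwZ hZlo hZloZ hM) (measure_ne_top q _)
    (target_weight_gt_le_unnormalised hw hw0 hwt hwZ hwt0 hZlo hZloZ hZhi hM) ENNReal.ofReal_ne_top

/-- **… WITH CERTIFIED NUMBERS IN PLACE OF THE PROXY MEANS**: if `ĉ ≤ E_q[min(1, w̃/Z_hi)]`, `q{M·Z_lo < w̃} ≤ t̂` and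
`ŝ ≤ E_q[w̃·1{w̃ ≤ M·Z_lo}]` — three one-sided statements each obtainable from the proposal stream by Hoeffding at a declared risk —
then `P(|H̄_R − π f| ≥ ε + (c − a)(1 − ŝ/Z_hi + ρ̂^k)) ≤ 2·exp(−Rε²/(2(σ² + (c − a)ε/3))) + R·(t̂ + ρ̂^k)`, `ρ̂ = 1 − ĉ/max(1, M)`. [ours] -/
theorem crnLag_replicas_burnIn_bernstein_abs_target_of_estimates [StandardBorelSpace Ω] [Nonempty Ω] [MeasurableSingletonClass Ω]
    [MeasurableEq Ω] [Fact (Measurable w)] (hw0 : ∀ y, 0 < w y) [IsProbabilityMeasure (q.withDensity fun y => ENNReal.ofReal (w y))]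
    (hwt : Measurable wt) (hwZ : ∀ y, w y = wt y / Znorm) (hwt0 : ∀ y, 0 ≤ wt y) (hZlo : 0 < Zlo) (hZloZ : Zlo ≤ Znorm)
    (hZhi : Znorm ≤ Zhi) (Khat : Kernel (Ω × Ω) (Ω × Ω)) [IsMarkovKernel Khat]
    (hK : ∀ z : Ω × Ω, Khat z = (q.prod (volume : Measure unitInterval)).map (fun p : Ω × unitInterval =>
      ((if (p.2 : ℝ) * w z.1 ≤ w p.1 then p.1 else z.1), (if (p.2 : ℝ) * w z.2 ≤ w p.1 then p.1 else z.2))))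
    (x : Ω) {M : ℝ} (hM : 0 ≤ M) (hxM : wt x ≤ M * Zlo) (ν : Measure (Ω × Ω)) [IsProbabilityMeasure ν]
    (hν : ν = (indepMH q w x).map fun y : Ω => (y, x)) {f : Ω → ℝ} (hf : Measurable f) {a c : ℝ} (ha : ∀ y, a ≤ f y)
    (hc : ∀ y, f y ≤ c) (k N : ℕ) (hZm : ∀ j, Measurable (Z j))
    (hlaw : ∀ j, μ.map (Z j) = Kernel.trajMeasure (X := fun _ : ℕ => Ω × Ω) ν
      (fun n : ℕ => Khat.comap (fun h : (i : ↥(Finset.Iic n)) → Ω × Ω => h ⟨n, Finset.mem_Iic.2 le_rfl⟩)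
        (measurable_pi_apply _)))
    (hind : iIndepFun Z μ) {σ2 : ℝ} (hσ : 0 < σ2)
    (hσk : variance f ((fun m : Measure Ω => m.bind (indepMH q w))^[k] (Measure.dirac x)) ≤ σ2)
    {ε : ℝ} (hε : 0 ≤ ε) {R : ℕ} (hR : 1 ≤ R) {chat that shat : ℝ}
    (hchat : chat ≤ ∫ y, min 1 (wt y / Zhi) ∂q) (hthat : q.real {y | M * Zlo < wt y} ≤ that)
    (hshat : shat ≤ ∫ y, Set.indicator {y | wt y ≤ M * Zlo} wt y ∂q) :
    μ.real {ω | ε + (c - a) * (ENNReal.ofReal (1 - shat / Zhi) + (1 - ENNReal.ofReal chat / ENNReal.ofReal (max 1 M)) ^ k).toReal ≤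
        |(R : ℝ)⁻¹ * ∑ j ∈ range R, (f ((Z j ω k).2) + ∑ n ∈ range N, (f ((Z j ω (k + n)).1) - f ((Z j ω (k + n)).2))) -
          ∫ y, f y ∂(q.withDensity fun y => ENNReal.ofReal (w y))|} ≤
      2 * Real.exp (-(R * ε ^ 2) / (2 * (σ2 + (c - a) * ε / 3))) +
        R * (ENNReal.ofReal that + (1 - ENNReal.ofReal chat / ENNReal.ofReal (max 1 M)) ^ k).toReal := by
  have hw : Measurable w := Fact.out
  have hZ : 0 < Znorm := lt_of_lt_of_le hZlo hZloZ
  have hZhi0 : 0 < Zhi := lt_of_lt_of_le hZ hZhi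
  -- `ofReal ĉ ≤ ∫⁻ min(1, w̃/Z_hi) ≤ c₁`
  have hmin_i : Integrable (fun y => min 1 (wt y / Zhi)) q :=
    Integrable.of_bound ((measurable_const.min (hwt.div_const Zhi)).aestronglyMeasurable) 1 (ae_of_all _ fun y => by
      rw [Real.norm_eq_abs, abs_of_nonneg (le_min zero_le_one (div_nonneg (hwt0 y) hZhi0.le))]; exact min_le_left _ _)
  have hc₀ : ENNReal.ofReal chat ≤ ∫⁻ y, ENNReal.ofReal (min 1 (w y)) ∂q := by
    refine le_trans ?_ (lintegral_min_one_unnormalised_le hwZ hwt0 hZ hZhi)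
    rw [← ofReal_integral_eq_lintegral_ofReal hmin_i (ae_of_all _ fun y => le_min zero_le_one (div_nonneg (hwt0 y) hZhi0.le))]
    exact ENNReal.ofReal_le_ofReal hchat
  have htq : q {y | M < w y} ≤ ENNReal.ofReal that := by
    refine (measure_weight_gt_le_unnormalised hwZ hZlo hZloZ hM).trans ?_
    rw [← ENNReal.ofReal_toReal (measure_ne_top q _)]
    exact ENNReal.ofReal_le_ofReal hthat
  have htπ : (q.withDensity fun y => ENNReal.ofReal (w y)) {y | M < w y} ≤ ENNReal.ofReal (1 - shat / Zhi) :=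
    (target_weight_gt_le_unnormalised hw hw0 hwt hwZ hwt0 hZlo hZloZ hZhi hM).trans
      (ENNReal.ofReal_le_ofReal (by have := div_le_div_of_nonneg_right hshat hZhi0.le; linarith))
  exact crnLag_replicas_burnIn_bernstein_abs_target_of_inputs hw0 Khat hK x (weight_le_of_unnormalised_le hwZ hZlo hZloZ hM hxM)
    ν hν hf ha hc k N hZm hlaw hind hσ hσk hε hR hc₀ htq ENNReal.ofReal_ne_top htπ ENNReal.ofReal_ne_top

end Calibrated

end Summit.Ventures.LatticeQCDFlow.Exactness
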